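import Literature.NumberTheory.Weil1965.AdelicSiegelMeasureIntegral
import Literature.NumberTheory.Weil1965.AdelicSiegelFunctionalTempered
import HarnessLib

/-!
# The complex-linear Eisenstein functional `E_X : 𝒮(𝔸_F^ι) →ₗ[ℂ] ℂ`, `Φ ↦ Σ_ξ F*_Φ(ξ)`: Fourier-side bound and monotonicity

Topic `NumberTheory/Weil1965`; namespace `Literature.NumberTheory.Weil1965`.  ONE definition (`adelicSiegelFunctionalC`, the `ℂ`-linear
extension of R4's positive functional `adelicSiegelFunctional` on `𝒮_ℝ`) and kernel theorems; no named fact, no `axiom`, no `sorry`.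
Sequel of ★ `AdelicFibreMeasures` (R4), ★ `AdelicSiegelFunctionalComplex`, ★ `AdelicSiegelFunctionalTempered` (B-p02), ★
`AdelicSiegelMeasureIntegral` ∕ `AdelicSiegelCoeffHeightBound`.

[Weil1965, Chap. IV n° 41 (34)–(35)]: Weil's `E_X(Φ) = Σ_{ξ ∈ F} F*_Φ(ξ)` is a TEMPERED POSITIVE MEASURE on `X = 𝔸_F^ι`.  The tree carries it
as the positive `ℝ`-linear functional `adelicSiegelFunctional` on `𝒮_ℝ(X)` (R4); the Siegel–Weil assemblies (the Borel-bound sheet's letter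
(E_X) with binders `EE, hEE, hEEmono`; the I-CLOSE outer assembly's `S_E`) consume it as a `ℂ`-LINEAR functional on `𝒮(X)`:

* `adelicSiegelFunctionalC μ h hh hB : piSchwartzBruhat F ι →ₗ[ℂ] ℂ`, `Φ ↦ Σ'_ξ F*_Φ(ξ)` (additive by condition (B) `hB`);
  `adelicSiegelFunctionalC_apply`, `adelicSiegelFunctionalC_eq_re_add_im` (`= E_X(Re Φ) + i E_X(Im Φ)`, ★ `tsum_adelicSiegelCoeff_eq_re_add_im`),
  `adelicSiegelFunctionalC_ofReal` (`= E_X(Ψ)` on real `Ψ`);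
* **Fourier-side bound** `enorm_adelicSiegelFunctionalC_le_tsum` (`‖E_X Φ‖ₑ ≤ Σ'_ξ ‖F*_Φ(ξ)‖ₑ`) and, for `h = q_S`,
  `enorm_adelicSiegelFunctionalC_sdForm_le_tsum_integral_chirp` (`… ≤ Σ'_ξ ‖∫ chirp(ξ•S) Φ dν‖ₑ` — the letter `hEE` token-for-token);
* **the functional IS the measure** `adelicSiegelFunctionalC_eq_integral_of_tempered` (`E_X Φ = ∫ Φ dν₀` under temperedness, B-p02) and
  `adelicSiegelFunctionalC_sdForm_eq_integral` (unconditionally for `h = q_S`, `F` totally real, `S` symmetric, `det S ≠ 0`, `4 < m`);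
* **monotonicity under domination** `enorm_adelicSiegelFunctionalC_mono_of_tempered` ∕ `enorm_adelicSiegelFunctionalC_sdForm_mono`:
  `‖Φ‖ ≤ Re Ψ` pointwise ⇒ `‖E_X Φ‖ₑ ≤ ‖E_X Ψ‖ₑ` (the letter `hEEmono` token-for-token) — `‖∫Φ‖ ≤ ∫‖Φ‖ ≤ ∫ Re Ψ = Re ∫Ψ ≤ ‖∫Ψ‖`,
  i.e. exactly the positivity of the tempered MEASURE `E_X` on all of `𝒮(X)`.

Cell `hodgecm-mathlib`, FLOOR 0, crux H413 (stmt-HodgeConjecture-24833), E-2 ∕ SW2, row (E_X) STRUCTURE LETTER (F0P4-p06 (g3)).  HC_CM is proved only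
modulo the printed citations until rung 0 closes; this file is unconditional.

## References
* [Weil1965] A. Weil, *Sur la formule de Siegel dans la théorie des groupes classiques*, Acta Math. 113 (1965): Chap. I n° 2 Lemme 3 p. 7;
  Chap. IV n° 41 (34)–(35) p. 59; Chap. V n° 48 Lemme 21 p. 68.
-/

set_option autoImplicit false

noncomputable section

open MeasureTheory Filter Topology Set NumberField IsDedekindDomain
open scoped NNReal ENNReal Matrix Classical
open Literature.NumberTheory.Automorphic Literature.NumberTheory.Weil1964

namespace Literature.NumberTheory.Weil1965

section Generic

variable (F : Type) [Field F] [NumberField F] (ι : Type) [Fintype ι]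
  [MeasurableSpace (adeleQuotient F)] [BorelSpace (adeleQuotient F)]
  [MeasurableSpace (AdeleRing (𝓞 F) F)] [BorelSpace (AdeleRing (𝓞 F) F)]
  (μ : Measure (ι → AdeleRing (𝓞 F) F)) [μ.IsAddHaarMeasure]
  (h : (ι → AdeleRing (𝓞 F) F) → AdeleRing (𝓞 F) F) (hh : Continuous h)
  (hB : ∀ Φ ∈ piSchwartzBruhat F ι, Summable fun ξ : F => ‖adelicSiegelCoeff F ι μ h Φ ξ‖)

/-- **Weil's Eisenstein functional on COMPLEX test functions**, `E_X(Φ) = Σ'_{ξ ∈ F} F*_Φ(ξ)`, as a `ℂ`-linear map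
`𝒮(𝔸_F^ι) →ₗ[ℂ] ℂ` (additivity by condition (B) `hB`; the `ℂ`-linear extension of R4's `adelicSiegelFunctional` on `𝒮_ℝ`,
`adelicSiegelFunctionalC_eq_re_add_im`). [cite: Weil1965, Chap. IV n° 41, (34) p. 59] -/
def adelicSiegelFunctionalC : piSchwartzBruhat F ι →ₗ[ℂ] ℂ where
  toFun Φ := ∑' ξ : F, adelicSiegelCoeff F ι μ h (Φ : (ι → AdeleRing (𝓞 F) F) → ℂ) ξ
  map_add' Φ₁ Φ₂ := by
    have hsplit : ((Φ₁ + Φ₂ : piSchwartzBruhat F ι) : (ι → AdeleRing (𝓞 F) F) → ℂ) =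
        (Φ₁ : (ι → AdeleRing (𝓞 F) F) → ℂ) + (Φ₂ : (ι → AdeleRing (𝓞 F) F) → ℂ) := rfl
    rw [hsplit, ← (hB _ Φ₁.2).of_norm.tsum_add (hB _ Φ₂.2).of_norm]
    exact tsum_congr fun ξ => adelicSiegelCoeff_add hh (integrable_of_mem_piSchwartzBruhat Φ₁.2)
      (integrable_of_mem_piSchwartzBruhat Φ₂.2) ξ
  map_smul' a Φ := by
    have hsplit : ((a • Φ : piSchwartzBruhat F ι) : (ι → AdeleRing (𝓞 F) F) → ℂ) = a • (Φ : (ι → AdeleRing (𝓞 F) F) → ℂ) := rfl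
    rw [hsplit, RingHom.id_apply, smul_eq_mul, ← tsum_mul_left]
    exact tsum_congr fun ξ => adelicSiegelCoeff_smul a _ ξ

variable {F ι μ h}

omit [MeasurableSpace (adeleQuotient F)] [BorelSpace (adeleQuotient F)] in
/-- Unfolding: `E_X(Φ) = Σ'_ξ F*_Φ(ξ)`. [cite: Weil1965, Chap. IV n° 41, (34) p. 59] -/
theorem adelicSiegelFunctionalC_apply (Φ : piSchwartzBruhat F ι) :
    adelicSiegelFunctionalC F ι μ h hh hB Φ = ∑' ξ : F, adelicSiegelCoeff F ι μ h (Φ : (ι → AdeleRing (𝓞 F) F) → ℂ) ξ := rfl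

omit [MeasurableSpace (adeleQuotient F)] [BorelSpace (adeleQuotient F)] in
/-- **`E_X(Φ) = E_X(Re Φ) + i · E_X(Im Φ)`**: the `ℂ`-linear functional in terms of R4's positive functional on `𝒮_ℝ`
(★ `tsum_adelicSiegelCoeff_eq_re_add_im`). [cite: Weil1965, Chap. IV n° 41, (34) p. 59] -/
theorem adelicSiegelFunctionalC_eq_re_add_im (Φ : piSchwartzBruhat F ι) :
    adelicSiegelFunctionalC F ι μ h hh hB Φ =
      (adelicSiegelFunctional F ι μ h hh hB ⟨fun v => ((Φ : (ι → AdeleRing (𝓞 F) F) → ℂ) v).re, re_mem_piSchwartzBruhatReal Φ.2⟩ : ℂ) +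
        Complex.I *
          (adelicSiegelFunctional F ι μ h hh hB ⟨fun v => ((Φ : (ι → AdeleRing (𝓞 F) F) → ℂ) v).im, im_mem_piSchwartzBruhatReal Φ.2⟩ : ℂ) :=
  tsum_adelicSiegelCoeff_eq_re_add_im F ι hh hB Φ.2

omit [MeasurableSpace (adeleQuotient F)] [BorelSpace (adeleQuotient F)] in
/-- **On real test functions `E_X` is R4's functional**: `E_X(Ψ_ℂ) = E_X(Ψ)` for `Ψ ∈ 𝒮_ℝ(X)`, `Ψ_ℂ = (Ψ : ℂ)`.
[cite: Weil1965, Chap. IV n° 41, (34) p. 59] -/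
theorem adelicSiegelFunctionalC_ofReal (Ψ : piSchwartzBruhatReal F ι) :
    adelicSiegelFunctionalC F ι μ h hh hB ⟨fun v => ((Ψ : (ι → AdeleRing (𝓞 F) F) → ℝ) v : ℂ),
        (mem_piSchwartzBruhatReal_iff).1 Ψ.2⟩ = (adelicSiegelFunctional F ι μ h hh hB Ψ : ℂ) :=
  (ofReal_adelicSiegelFunctional F ι hh hB Ψ).symm

omit [MeasurableSpace (adeleQuotient F)] [BorelSpace (adeleQuotient F)] in
/-- **FOURIER-SIDE BOUND**: `‖E_X(Φ)‖ₑ ≤ Σ'_ξ ‖F*_Φ(ξ)‖ₑ`. [cite: Weil1965, Chap. V n° 48, Lemme 21, p. 68] -/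
theorem enorm_adelicSiegelFunctionalC_le_tsum (Φ : piSchwartzBruhat F ι) :
    (‖adelicSiegelFunctionalC F ι μ h hh hB Φ‖ₑ : ℝ≥0∞) ≤
      ∑' ξ : F, (‖adelicSiegelCoeff F ι μ h (Φ : (ι → AdeleRing (𝓞 F) F) → ℂ) ξ‖ₑ : ℝ≥0∞) :=
  enorm_tsum_le_tsum_enorm

/-- **THE FUNCTIONAL IS ITS MEASURE on all of `𝒮(X)`** under temperedness: `E_X(Φ) = ∫ Φ dν₀` (★ B-p02
`tsum_adelicSiegelCoeff_eq_integral_of_tempered`). [cite: Weil1965, Chap. IV n° 41, (35) p. 59] -/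
theorem adelicSiegelFunctionalC_eq_integral_of_tempered
    (htemp : ∀ Ψ : piSchwartzBruhatReal F ι,
      Integrable (Ψ : (ι → AdeleRing (𝓞 F) F) → ℝ) (adelicSiegelMeasure F ι μ h hh hB) ∧
        ∫ x, (Ψ : (ι → AdeleRing (𝓞 F) F) → ℝ) x ∂(adelicSiegelMeasure F ι μ h hh hB) = adelicSiegelFunctional F ι μ h hh hB Ψ)
    (Φ : piSchwartzBruhat F ι) :
    adelicSiegelFunctionalC F ι μ h hh hB Φ = ∫ x, (Φ : (ι → AdeleRing (𝓞 F) F) → ℂ) x ∂(adelicSiegelMeasure F ι μ h hh hB) :=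
  tsum_adelicSiegelCoeff_eq_integral_of_tempered F ι hh hB htemp Φ.2

/-- **MONOTONICITY UNDER POINTWISE DOMINATION** (the letter `hEEmono`): under temperedness, `‖Φ‖ ≤ Re Ψ` pointwise implies
`‖E_X(Φ)‖ₑ ≤ ‖E_X(Ψ)‖ₑ` — `‖∫ Φ dν₀‖ ≤ ∫ ‖Φ‖ dν₀ ≤ ∫ Re Ψ dν₀ = Re ∫ Ψ dν₀ ≤ ‖∫ Ψ dν₀‖`: positivity of the tempered measure `E_X`.
[cite: Weil1965, Chap. IV n° 41, (35) p. 59; Chap. V n° 48 Lemme 21, p. 68] -/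
theorem enorm_adelicSiegelFunctionalC_mono_of_tempered
    (htemp : ∀ Ψ : piSchwartzBruhatReal F ι,
      Integrable (Ψ : (ι → AdeleRing (𝓞 F) F) → ℝ) (adelicSiegelMeasure F ι μ h hh hB) ∧
        ∫ x, (Ψ : (ι → AdeleRing (𝓞 F) F) → ℝ) x ∂(adelicSiegelMeasure F ι μ h hh hB) = adelicSiegelFunctional F ι μ h hh hB Ψ)
    {Φ Ψ : piSchwartzBruhat F ι}
    (hle : ∀ x, ‖(Φ : (ι → AdeleRing (𝓞 F) F) → ℂ) x‖ ≤ (((Ψ : (ι → AdeleRing (𝓞 F) F) → ℂ) x).re)) :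
    (‖adelicSiegelFunctionalC F ι μ h hh hB Φ‖ₑ : ℝ≥0∞) ≤ ‖adelicSiegelFunctionalC F ι μ h hh hB Ψ‖ₑ := by
  have hiΦ : Integrable (Φ : (ι → AdeleRing (𝓞 F) F) → ℂ) (adelicSiegelMeasure F ι μ h hh hB) :=
    integrable_adelicSiegelMeasure_of_tempered F ι hh hB htemp Φ.2
  have hiΨ : Integrable (Ψ : (ι → AdeleRing (𝓞 F) F) → ℂ) (adelicSiegelMeasure F ι μ h hh hB) :=
    integrable_adelicSiegelMeasure_of_tempered F ι hh hB htemp Ψ.2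
  rw [adelicSiegelFunctionalC_eq_integral_of_tempered hh hB htemp, adelicSiegelFunctionalC_eq_integral_of_tempered hh hB htemp,
    ← ofReal_norm, ← ofReal_norm]
  refine ENNReal.ofReal_le_ofReal ?_
  calc ‖∫ x, (Φ : (ι → AdeleRing (𝓞 F) F) → ℂ) x ∂(adelicSiegelMeasure F ι μ h hh hB)‖
      ≤ ∫ x, ‖(Φ : (ι → AdeleRing (𝓞 F) F) → ℂ) x‖ ∂(adelicSiegelMeasure F ι μ h hh hB) := norm_integral_le_integral_norm _
    _ ≤ ∫ x, (((Ψ : (ι → AdeleRing (𝓞 F) F) → ℂ) x).re) ∂(adelicSiegelMeasure F ι μ h hh hB) :=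
        integral_mono hiΦ.norm hiΨ.re hle
    _ = (∫ x, (Ψ : (ι → AdeleRing (𝓞 F) F) → ℂ) x ∂(adelicSiegelMeasure F ι μ h hh hB)).re := by
        have := integral_re hiΨ
        simpa only [RCLike.re_to_complex] using this
    _ ≤ ‖∫ x, (Ψ : (ι → AdeleRing (𝓞 F) F) → ℂ) x ∂(adelicSiegelMeasure F ι μ h hh hB)‖ := Complex.re_le_norm _

end Generic

/-! ## The quadratic map `h = q_S`: the Fourier-side bound in chirp currency; measure and monotonicity UNCONDITIONALLY -/

section Quadratic

variable (F : Type) [Field F] [NumberField F] {m : ℕ}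
  [MeasurableSpace (adeleQuotient F)] [BorelSpace (adeleQuotient F)]
  [MeasurableSpace (AdeleRing (𝓞 F) F)] [BorelSpace (AdeleRing (𝓞 F) F)]
  (ν : Measure (Fin m → AdeleRing (𝓞 F) F)) [ν.IsAddHaarMeasure] (S : Matrix (Fin m) (Fin m) F)
  (hh : Continuous fun x : Fin m → AdeleRing (𝓞 F) F => sdForm F (ratMatrix F S) x)
  (hB : ∀ Φ ∈ piSchwartzBruhat F (Fin m), Summable fun ξ : F =>
    ‖adelicSiegelCoeff F (Fin m) ν (fun x => sdForm F (ratMatrix F S) x) Φ ξ‖)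

omit [MeasurableSpace (adeleQuotient F)] [BorelSpace (adeleQuotient F)] in
/-- **FOURIER-SIDE BOUND IN CHIRP CURRENCY** (the letter `hEE` token-for-token): for `h = q_S`,
`‖E_X(Φ)‖ₑ ≤ Σ'_ξ ‖∫ chirp(ξ • S) Φ dν‖ₑ` (★ `adelicSiegelCoeff_sdForm_eq_integral_chirp`). [cite: Weil1965, Chap. V n° 48, Lemme 21, p. 68] -/
theorem enorm_adelicSiegelFunctionalC_sdForm_le_tsum_integral_chirp (Φ : piSchwartzBruhat F (Fin m)) :
    (‖adelicSiegelFunctionalC F (Fin m) ν (fun x => sdForm F (ratMatrix F S) x) hh hB Φ‖ₑ : ℝ≥0∞) ≤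
      ∑' ξ : F, (‖∫ x, chirp F ((algebraMap F (AdeleRing (𝓞 F) F) ξ) • ratMatrix F S)
        ((Φ : piSchwartzBruhat F (Fin m)) : (Fin m → AdeleRing (𝓞 F) F) → ℂ) x ∂ν‖ₑ : ℝ≥0∞) := by
  refine (enorm_adelicSiegelFunctionalC_le_tsum hh hB Φ).trans (le_of_eq (tsum_congr fun ξ => ?_))
  rw [adelicSiegelCoeff_sdForm_eq_integral_chirp]

/-- **`E_X(Φ) = ∫ Φ dν₀` UNCONDITIONALLY for `h = q_S`** (`F` totally real, `S` symmetric, `det S ≠ 0`, `4 < m`; temperedness from ★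
`integral_adelicSiegelMeasure_sdForm_eq_of_mem`). [cite: Weil1965, Chap. IV n° 41, (35) p. 59] -/
theorem adelicSiegelFunctionalC_sdForm_eq_integral [IsTotallyReal F] (hm : 4 < m) (hS : S.IsSymm) (hdet : S.det ≠ 0)
    (Φ : piSchwartzBruhat F (Fin m)) :
    adelicSiegelFunctionalC F (Fin m) ν (fun x => sdForm F (ratMatrix F S) x) hh hB Φ =
      ∫ x, (Φ : (Fin m → AdeleRing (𝓞 F) F) → ℂ) x ∂(adelicSiegelMeasure F (Fin m) ν (fun x => sdForm F (ratMatrix F S) x) hh hB) :=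
  adelicSiegelFunctionalC_eq_integral_of_tempered hh hB (integral_adelicSiegelMeasure_sdForm_eq_of_mem F ν hm hS hdet hh hB) Φ

/-- **MONOTONICITY UNDER DOMINATION, UNCONDITIONALLY for `h = q_S`** (the letter `hEEmono` token-for-token): `‖Φ‖ ≤ Re Ψ` pointwise
⇒ `‖E_X(Φ)‖ₑ ≤ ‖E_X(Ψ)‖ₑ`. [cite: Weil1965, Chap. IV n° 41, (35) p. 59; Chap. V n° 48 Lemme 21, p. 68] -/
theorem enorm_adelicSiegelFunctionalC_sdForm_mono [IsTotallyReal F] (hm : 4 < m) (hS : S.IsSymm) (hdet : S.det ≠ 0)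
    (Φ Ψ : piSchwartzBruhat F (Fin m))
    (hle : ∀ x, ‖(Φ : (Fin m → AdeleRing (𝓞 F) F) → ℂ) x‖ ≤ (((Ψ : (Fin m → AdeleRing (𝓞 F) F) → ℂ) x).re)) :
    (‖adelicSiegelFunctionalC F (Fin m) ν (fun x => sdForm F (ratMatrix F S) x) hh hB Φ‖ₑ : ℝ≥0∞) ≤
      ‖adelicSiegelFunctionalC F (Fin m) ν (fun x => sdForm F (ratMatrix F S) x) hh hB Ψ‖ₑ :=
  enorm_adelicSiegelFunctionalC_mono_of_tempered hh hB (integral_adelicSiegelMeasure_sdForm_eq_of_mem F ν hm hS hdet hh hB) hle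

end Quadratic

end Literature.NumberTheory.Weil1965

end
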